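import Summits.BirchSwinnertonDyer.Rank1Residual.Iwasawa.LocalTowerKernelCardLeTorsion
import Summits.BirchSwinnertonDyer.Rank1Residual.X11b.BDPRouteNonsingularTorsionDivisible
import Summits.BirchSwinnertonDyer.Rank1Residual.Iwasawa.UnramifiedConditionFiniteOrbit
import Literature.NumberTheory.EllipticCurves.LocalFrobeniusGenerationProofs
import HarnessLib

/-!
# BSD rank-≤1 residual cell — inputs for the `p`-divisibility of `E₀(K_{∞,η})[p^∞]` at `v ∤ p`
# (TOOL; row T-CTL-L1, FILE 1a): `E₀` is a `Γ_{K_v}`-stable subgroup, finite layers, the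
# cyclotomic non-split hypothesis

HONEST FRAMING (cell `b2b-bsdres-*`, team n1011, verbatim): prove what is provable now; shrink each
hard class to its core with data; no claim beyond stated classes. Research route; TOOL theorems
only — no definition, no named fact, nothing booked, no residual-map mark moved, no class closed.
Row T-CTL-L1 of `cells/n1011/OWNERS.md` (seat n1011-p12 GEN 12; idle rule R3-25 (f); lead R5-94 (c):
a stand-alone K-general TOOL — the input `(L1)` named in ROUTE-2 §II.42.2, in the `localPoints`
currency of `Iwasawa/LocalTowerKernelCardLeTorsion.lean` (row T-CTL-TAM F2); row T-CTL-TAM's F6 does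
not consume it). This file holds the inputs of the divisibility theorem (sibling file
`Iwasawa/NonsingularTorsionDivisibleTower.lean`):

* `reducesToNonsingular_transport_smul_iff` — along an equivariant transport `Φ` of `E(K̄_v)` to the
  local minimal model (the binders `Φ`, `hΦ` of X11b's `BDPRouteNonsingularPart`), the set `E₀` of points
  whose transport has non-singular reduction (`ReducesToNonsingular` for the spectral valuation) is
  stable under `Γ_{K_v}` (Silverman, *AEC*, VII.§2, VIII.§1);
* `exists_addSubgroup_mem_iff_reducesToNonsingular` — `E₀` is a subgroup (Prop. VII.2.1), def-free;
* `padicInt_eq_zero_of_forall_pow_dvd`, `pow_dvd_natCast_padicInt_iff`, `sum_range_add_eq_of_periodic`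
  — elementary helpers;
* `exists_layer_le_stabilizer` — a point of `E(K_{∞,η})` (an `H_{v,∞}`-fixed local point) lies in a
  finite layer `E(K_{n,w})` (`H_{v,∞} = ⋂ₙ H_{v,n}`, compactness of `Γ_{K_v}`);
* `exists_not_mem_localSubgroup_of_isCyclotomic` — in the CYCLOTOMIC `ℤ_p`-extension no `v ∤ p`
  splits completely (`K : Type`).

References: [GreenbergLNM1716] §3 (pp. 86–87); [SilvermanAEC2009] VII.§2, VIII.§1;
[Washington1997] §13.1.
-/

noncomputable section

open scoped Classical NNReal

open NumberField IsDedekindDomain Field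

universe u

namespace Summit.BirchSwinnertonDyer.Rank1Residual.Iwasawa.NonsingularTower

open Literature.NumberTheory.EllipticCurves Literature.NumberTheory.GaloisRepresentations
  IsDedekindDomain.HeightOneSpectrum WeierstrassCurve
  Summit.BirchSwinnertonDyer.Rank1Residual.X11b.AcSelmer

variable {K : Type u} [Field K] [NumberField K] (W : WeierstrassCurve K)
  {v : HeightOneSpectrum (𝓞 K)} {p : ℕ} [Fact p.Prime] (κ : ZpExtension K p)
  {w : Valuation (AlgebraicClosure (v.adicCompletion K)) ℝ≥0}
  (hw : ∀ x, (w x : ℝ) =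
    spectralNorm (v.adicCompletion K) (AlgebraicClosure (v.adicCompletion K)) x)
  {Φ : localPoints W (v.adicCompletion K) ≃+
    (((W.localMinimalIntegralModel v).map (algebraMap (v.adicCompletionIntegers K)
      (v.adicCompletion K))).baseChange (AlgebraicClosure (v.adicCompletion K))).toAffine.Point}
  (hΦ : ∀ (σ : absoluteGaloisGroup (v.adicCompletion K)) (Q : localPoints W (v.adicCompletion K)),
    Φ (σ • Q) = Affine.Point.map ((absoluteGaloisGroup.toAlgEquiv _ σ :
        AlgebraicClosure (v.adicCompletion K) ≃ₐ[v.adicCompletion K]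
          AlgebraicClosure (v.adicCompletion K)) :
        AlgebraicClosure (v.adicCompletion K) →ₐ[v.adicCompletion K]
          AlgebraicClosure (v.adicCompletion K)) (Φ Q))

/-! ## `E₀(K̄_v)` (through the transport `Φ`) is a `Γ_{K_v}`-stable subgroup of `E(K̄_v)` -/

section Subgroup

include hw hΦ in
/-- **`E₀` is stable under `Γ_{K_v}`**: for `σ ∈ Γ_{K_v}` and `Q ∈ E(K̄_v)`, `Φ (σ • Q)` reduces to a
non-singular point of the local minimal model iff `Φ Q` does — `σ` is an isometry of the spectral
valuation (`spectralValuation_smul`) fixing the equation (tree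
`reducesToNonsingular_map_iff_of_forall_eq`). [cite: SilvermanAEC2009, VII.§2 and VIII.§1 (Galois acts on `E₀`)] -/
theorem reducesToNonsingular_transport_smul_iff (σ : absoluteGaloisGroup (v.adicCompletion K))
    (Q : localPoints W (v.adicCompletion K)) :
    ReducesToNonsingular w (IsLocalRing.residue w.integer) (Φ (σ • Q)) ↔
      ReducesToNonsingular w (IsLocalRing.residue w.integer) (Φ Q) := by
  haveI := WeierstrassCurve.isIntegral_spectralValuation_baseChange hw
    (W.localMinimalIntegralModel v)
  rw [hΦ]
  exact reducesToNonsingular_map_iff_of_forall_eq _ _ (fun z ↦ spectralValuation_smul hw σ z) _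

include hw in
omit [Fact p.Prime] in
/-- **`E₀` is a subgroup** (def-free form): there is an additive subgroup of `E(K̄_v)` whose members
are exactly the points `Q` with `Φ Q` of non-singular reduction — the pull-back along `Φ` and the
identity-on-coordinates transport to an `𝒪_w`-model `W₀` of the tree's
`ReductionHomomorphism.nonsingularReductionSubgroup` (Silverman, *AEC*, Prop. VII.2.1).
[cite: SilvermanAEC2009, Prop. VII.2.1] -/
theorem exists_addSubgroup_mem_iff_reducesToNonsingular
    (Φ : localPoints W (v.adicCompletion K) ≃+
      (((W.localMinimalIntegralModel v).map (algebraMap (v.adicCompletionIntegers K)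
        (v.adicCompletion K))).baseChange (AlgebraicClosure (v.adicCompletion K))).toAffine.Point) :
    ∃ S : AddSubgroup (localPoints W (v.adicCompletion K)),
      ∀ Q, Q ∈ S ↔ ReducesToNonsingular w (IsLocalRing.residue w.integer) (Φ Q) := by
  haveI hint := WeierstrassCurve.isIntegral_spectralValuation_baseChange hw
    (W.localMinimalIntegralModel v)
  obtain ⟨W₀, hW₀⟩ := hint.integral
  have hv0 : w.Integers w.integer := Valuation.integer.integers w
  refine ⟨((W₀.nonsingularReductionSubgroup hv0).comap
    (Affine.Point.congrEquiv hW₀).toAddMonoidHom).comap Φ.toAddMonoidHom, fun Q ↦ ?_⟩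
  rw [AddSubgroup.mem_comap, AddSubgroup.mem_comap, mem_nonsingularReductionSubgroup_iff,
    ← reducesToNonsingular_iff_hasNonsingularReduction W₀]
  exact reducesToNonsingular_congrEquiv_iff _ hW₀ _

end Subgroup

/-! ## Three elementary helpers (`ℤ_p` divisibility; sums over a period) -/

section Helpers

omit [Fact p.Prime] in
/-- An element of `ℤ_p` divisible by every power of `p` is `0` (its norm is `≤ p⁻ⁿ` for all `n`).
[folklore] -/
theorem padicInt_eq_zero_of_forall_pow_dvd [Fact p.Prime] (x : ℤ_[p])
    (h : ∀ n : ℕ, (p : ℤ_[p]) ^ n ∣ x) : x = 0 := by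
  by_contra hne
  have hpos : 0 < ‖x‖ := norm_pos_iff.mpr hne
  have hp1 : ((p : ℝ)⁻¹) < 1 := by
    have : (1 : ℝ) < p := by exact_mod_cast (Fact.out : p.Prime).one_lt
    exact inv_lt_one_of_one_lt₀ this
  obtain ⟨n, hn⟩ := exists_pow_lt_of_lt_one hpos hp1
  have hle : ‖x‖ ≤ (p : ℝ) ^ (-(n : ℤ)) :=
    (PadicInt.norm_le_pow_iff_mem_span_pow _ n).mpr (Ideal.mem_span_singleton.mpr (h n))
  rw [zpow_neg, zpow_natCast, ← inv_pow] at hle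
  exact absurd (hn.trans_le hle) (lt_irrefl _)

omit [Fact p.Prime] in
/-- `(p ^ n : ℤ_p) ∣ (m : ℤ_p)` for a natural number `m` iff `p ^ n ∣ m` (reduction to `ℤ/pⁿ`,
`PadicInt.ker_toZModPow`). [folklore] -/
theorem pow_dvd_natCast_padicInt_iff [Fact p.Prime] (n m : ℕ) :
    (p : ℤ_[p]) ^ n ∣ (m : ℤ_[p]) ↔ p ^ n ∣ m := by
  haveI : NeZero (p ^ n) := ⟨pow_ne_zero _ (Fact.out : p.Prime).ne_zero⟩
  rw [← ZMod.natCast_eq_zero_iff, ← map_natCast (PadicInt.toZModPow n), ← RingHom.mem_ker,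
    PadicInt.ker_toZModPow, Ideal.mem_span_singleton]

/-- **Sums over a full period are shift-invariant**: if `a (i + T) = a i` for all `i` then
`∑_{i<T} a (i + c) = ∑_{i<T} a i`. [folklore] -/
theorem sum_range_add_eq_of_periodic {M : Type*} [AddCommGroup M] (a : ℕ → M) (T : ℕ)
    (ha : ∀ i, a (i + T) = a i) (c : ℕ) :
    ∑ i ∈ Finset.range T, a (i + c) = ∑ i ∈ Finset.range T, a i := by
  induction c with
  | zero => simp
  | succ c ih =>
    have h1 := Finset.sum_range_succ' (fun i ↦ a (i + c)) T
    have h2 := Finset.sum_range_succ (fun i ↦ a (i + c)) T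
    have hT : a (T + c) = a (0 + c) := by rw [zero_add, add_comm, ha]
    simp only [hT] at h2
    have h3 : ∑ i ∈ Finset.range T, a (i + 1 + c) = ∑ i ∈ Finset.range T, a (i + c) :=
      add_right_cancel (h1.symm.trans h2)
    rw [← ih]
    refine (Finset.sum_congr rfl fun i _ ↦ ?_).trans h3
    rw [add_assoc, add_comm c 1]

end Helpers

/-! ## An `H_{v,∞}`-fixed local point lies in a finite layer -/

section Layer

/-- **A point of `E(K_{∞,η})` is defined over some finite layer `K_{n,w}`**: if `P ∈ E(K̄_v)` is fixed
by `H_{v,∞} = (Γ_{K_v} → Γ_K)⁻¹(Gal(K̄/K_∞))` then it is fixed by `H_{v,n} = (Γ_{K_v} → Γ_K)⁻¹(Gal(K̄/K_n))`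
for some `n`: the stabiliser of `P` is open, `H_{v,∞} = ⋂ₙ H_{v,n}` (an element of `ℤ_p` divisible by
every `pⁿ` is `0`), and `Γ_{K_v}` is compact. Greenberg, LNM 1716, §3 p. 86 (`K_∞ = ⋃ K_n`).
[cite: GreenbergLNM1716, §3 p. 86] -/
theorem exists_layer_le_stabilizer (P : localPoints W (v.adicCompletion K))
    (hP : ∀ σ ∈ localSubgroup κ.kerSubgroup (v.adicCompletion K), σ • P = P) :
    ∃ n : ℕ, ∀ σ ∈ localSubgroup (κ.layerSubgroup n) (v.adicCompletion K), σ • P = P := by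
  haveI : CharZero (v.adicCompletion K) :=
    charZero_of_injective_algebraMap (algebraMap K (v.adicCompletion K)).injective
  let G : Type u := absoluteGaloisGroup (v.adicCompletion K)
  let U : Subgroup G := MulAction.stabilizer G P
  have hU : IsOpen (U : Set G) :=
    Literature.NumberTheory.EllipticCurves.isOpen_stabilizer_localPoints W _ P
  -- the closed sets `H_{v,n} \ U`
  let C : ℕ → Set G := fun n ↦
    (localSubgroup (κ.layerSubgroup n) (v.adicCompletion K) : Set G) ∩ (U : Set G)ᶜ
  have hCclosed : ∀ n, IsClosed (C n) := fun n ↦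
    (Subgroup.isClosed_of_isOpen _ (isOpen_localSubgroup_layerSubgroup _ κ n)).inter
      hU.isClosed_compl
  have hdir : Directed (· ⊇ ·) C := by
    intro m n
    refine ⟨max m n, fun σ hσ ↦ ⟨?_, hσ.2⟩, fun σ hσ ↦ ⟨?_, hσ.2⟩⟩
    · exact Subgroup.comap_mono (κ.layerSubgroup_antitone (le_max_left m n)) hσ.1
    · exact Subgroup.comap_mono (κ.layerSubgroup_antitone (le_max_right m n)) hσ.1
  have hempty : (Set.univ : Set G) ∩ ⋂ n, C n = ∅ := by
    rw [Set.univ_inter, Set.eq_empty_iff_forall_notMem]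
    intro σ hσ
    rw [Set.mem_iInter] at hσ
    have hmem : ∀ n, (p : ℤ_[p]) ^ n ∣ (κ (resGal (K := K) (v.adicCompletion K) σ)).toAdd :=
      fun n ↦ ZpExtension.mem_layerSubgroup.mp ((mem_localSubgroup_iff _ _ σ).mp (hσ n).1)
    have hzero : (κ (resGal (K := K) (v.adicCompletion K) σ)).toAdd = 0 :=
      padicInt_eq_zero_of_forall_pow_dvd (p := p) _ hmem
    have hσi : σ ∈ localSubgroup κ.kerSubgroup (v.adicCompletion K) := by
      rw [mem_localSubgroup_iff, ZpExtension.mem_kerSubgroup]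
      exact Multiplicative.toAdd.injective (by rw [toAdd_one]; exact hzero)
    exact (hσ 0).2 (hP σ hσi)
  obtain ⟨n, hn⟩ := isCompact_univ.elim_directed_family_closed C hCclosed hempty hdir
  refine ⟨n, fun σ hσ ↦ ?_⟩
  by_contra hσP
  have : σ ∈ (Set.univ : Set G) ∩ C n := ⟨Set.mem_univ _, hσ, hσP⟩
  rw [hn] at this
  exact this

end Layer

/-! ## The cyclotomic `ℤ_p`-extension: the non-split hypothesis holds at every `v ∤ p` -/

section Cyclotomic

/-- **In the CYCLOTOMIC `ℤ_p`-extension no finite place `v ∤ p` splits completely**: some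
`σ ∈ Γ_{K_v}` lies outside `Hi = (Γ_{K_v} → Γ_K)⁻¹(Gal(K̄/K_∞))` (a local Frobenius: its cyclotomic
character value `N v` has infinite order — the tree's
`Iwasawa.exists_mem_decomp_apply_ne_one_of_isCyclotomic`, transported along `resGal = absGaloisRestrict`).
So the hypothesis `hns` of `exists_nsmul_eq_of_forall_smul_eq` is discharged for `κ` cyclotomic.
(`K : Type`, the universe of the tree's Frobenius-value theorem.) [cite: Washington1997, §13.1] -/
theorem exists_not_mem_localSubgroup_of_isCyclotomic {L : Type} [Field L] [NumberField L]
    {q : ℕ} [Fact q.Prime] {μ : ZpExtension L q} (hμ : μ.IsCyclotomic)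
    {u : HeightOneSpectrum (𝓞 L)} (hqu : (q : 𝓞 L) ∉ u.asIdeal) :
    ∃ σ : absoluteGaloisGroup (u.adicCompletion L),
      σ ∉ localSubgroup μ.kerSubgroup (u.adicCompletion L) := by
  obtain ⟨δ, ⟨σ, rfl⟩, hδ⟩ := exists_mem_decomp_apply_ne_one_of_isCyclotomic hμ hqu
  exact ⟨σ, fun h ↦ hδ ((mem_localSubgroup_iff _ _ σ).mp h)⟩

end Cyclotomic

end Summit.BirchSwinnertonDyer.Rank1Residual.Iwasawa.NonsingularTower

end
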